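import Literature.Algebra.Polynomial.CasasAlvero.Char157Digits
import Literature.Algebra.Polynomial.CasasAlvero.Degree7Char157
import Literature.Algebra.Polynomial.CasasAlvero.Pentanomial
import Literature.Algebra.Polynomial.CasasAlvero.Degree6CandidatesPrime
import Literature.Algebra.Polynomial.CasasAlvero.FieldCorollaries
import Literature.Algebra.Polynomial.CasasAlvero.Degree5
import Literature.Algebra.Polynomial.CasasAlvero.Degree6
import Literature.Algebra.Polynomial.CasasAlvero.DigitReduction
import HarnessLib

/-!
# Casas-Alvero degrees in characteristic 157: the complete classification (seven good digits)

Over EVERY field `K` of characteristic `157`: `CA_d(K) ⟺ d = 0 ∨ d = a·157^k` with `1 ≤ a ≤ 7` — like `127`, a prime with SEVEN good digits.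
Ingredients: the digit reduction `CA_d ⇒ d = a·p^k ∧ CA_a` (`DigitReduction.lean`, any field); the positive digits `1, 2, 3, 4`
([GrafVonBothmerEtAl2007, Props. 2, 6]), `5` (`Degree5.lean`: `157` is not one of the nine bad primes of degree `5`), `6` (`157` is not among the `54`
candidate bad primes of degree `6` of `Degree6CandidatesPrime.lean`, so `CA_6` holds in characteristic `157` [CastryckLaterveerOunaies2012, Thm. 4]) and `7`
(`Degree7Char157.lean`: `157` is a GOOD prime for degree `7` — the kernel-checked scenario certificates `holdsInDegree_seven_of_char_157`; the bad primes of
degree `7` were computed in [CastryckLaterveerOunaies2012, Thm. 4] — with `CA_{7·157^k}` descending from the algebraic closure); and a refutation of every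
digit `8 ≤ a ≤ 156` over every field of characteristic `157`:
`16, 24, 30, 39, 69, 80, 81, 83, 94, 98, 99, 103, 105, 111, 114, 117, 125, 127, 132, 134, 137, 146, 147, 150, 156` by the binomial criterion
(`m = 6, 11, 6, 8, 16, 22, 8, 8, 7, 22, 39, 16, 45, 51, 15, 57, 8, 40, 6, 51, 9, 6, 19, 10, 2`); and the 124 remaining digits by the sparse `𝔽_157`-examples of `Char157Digits.lean`.
-/

noncomputable section

open Polynomial

set_option maxRecDepth 8192

namespace Literature.Algebra.Polynomial.CasasAlvero

section CharOneHundredFiftySeven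

variable (K : Type*) [Field K] [CharP K 157]

/-- `CA_{6·157^k}` over every field of characteristic `157` (`CA_6` itself — the case `k = 0` — holds because `157` is not among the
`54` candidate bad primes of degree `6` of `Degree6CandidatesPrime.lean`, `holdsInDegree_six_of_not_mem`, i.e. `157` is a GOOD prime for degree `6`
[cite: CastryckLaterveerOunaies2012, Thm. 4]). [cite: GrafVonBothmerEtAl2007, Prop. 6] -/
theorem holdsInDegree_six_mul_pow_of_char_157' (k : ℕ) : HoldsInDegree K (6 * 157 ^ k) := by
  haveI : Fact (Nat.Prime 157) := ⟨by norm_num⟩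
  exact holdsInDegree_mul_prime_pow_field K 157 (holdsInDegree_six_of_not_mem (K := AlgebraicClosure K) 157 (by decide)) k

set_option maxHeartbeats 1000000 in
/-- every digit `8 ≤ a < 157` fails: `¬ CA_a` over every field of characteristic `157` — the bad-prime computations of
[cite: CastryckLaterveerOunaies2012, Thm. 4] (degrees `≤ 7`) extended to every digit `8 ≤ a < 157` by explicit `𝔽_157`-rational examples and the
binomial criterion. [cite: GrafVonBothmerEtAl2007, Prop. 6] -/
theorem not_holdsInDegree_digit_of_char_oneHundredFiftySeven {a : ℕ} (h8 : 8 ≤ a) (hap : a < 157) : ¬ HoldsInDegree K a := by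
  haveI : Fact (Nat.Prime 157) := ⟨by norm_num⟩
  interval_cases a
  · exact not_holdsInDegree_eight_of_char_157 K
  · exact not_holdsInDegree_nine_of_char_157 K
  · exact not_holdsInDegree_ten_of_char_157 K
  · exact not_holdsInDegree_eleven_of_char_157 K
  · exact not_holdsInDegree_twelve_of_char_157 K
  · exact not_holdsInDegree_thirteen_of_char_157 K
  · exact not_holdsInDegree_fourteen_of_char_157 K
  · exact not_holdsInDegree_fifteen_of_char_157 K
  · exact not_holdsInDegree_of_choose_modEq_one K 157 (d := 16) (m := 6) (by norm_num) (by norm_num) (by decide)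
  · exact not_holdsInDegree_seventeen_of_char_157 K
  · exact not_holdsInDegree_eighteen_of_char_157 K
  · exact not_holdsInDegree_nineteen_of_char_157 K
  · exact not_holdsInDegree_twenty_of_char_157 K
  · exact not_holdsInDegree_twentyOne_of_char_157 K
  · exact not_holdsInDegree_twentyTwo_of_char_157 K
  · exact not_holdsInDegree_twentyThree_of_char_157 K
  · exact not_holdsInDegree_of_choose_modEq_one K 157 (d := 24) (m := 11) (by norm_num) (by norm_num) (by decide)
  · exact not_holdsInDegree_twentyFive_of_char_157 K
  · exact not_holdsInDegree_twentySix_of_char_157 K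
  · exact not_holdsInDegree_twentySeven_of_char_157 K
  · exact not_holdsInDegree_twentyEight_of_char_157 K
  · exact not_holdsInDegree_twentyNine_of_char_157 K
  · exact not_holdsInDegree_of_choose_modEq_one K 157 (d := 30) (m := 6) (by norm_num) (by norm_num) (by decide)
  · exact not_holdsInDegree_thirtyOne_of_char_157 K
  · exact not_holdsInDegree_thirtyTwo_of_char_157 K
  · exact not_holdsInDegree_thirtyThree_of_char_157 K
  · exact not_holdsInDegree_thirtyFour_of_char_157 K
  · exact not_holdsInDegree_thirtyFive_of_char_157 K
  · exact not_holdsInDegree_thirtySix_of_char_157 K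
  · exact not_holdsInDegree_thirtySeven_of_char_157 K
  · exact not_holdsInDegree_thirtyEight_of_char_157 K
  · exact not_holdsInDegree_of_choose_modEq_one K 157 (d := 39) (m := 8) (by norm_num) (by norm_num) (by decide)
  · exact not_holdsInDegree_forty_of_char_157 K
  · exact not_holdsInDegree_fortyOne_of_char_157 K
  · exact not_holdsInDegree_fortyTwo_of_char_157 K
  · exact not_holdsInDegree_fortyThree_of_char_157 K
  · exact not_holdsInDegree_fortyFour_of_char_157 K
  · exact not_holdsInDegree_fortyFive_of_char_157 K
  · exact not_holdsInDegree_fortySix_of_char_157 K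
  · exact not_holdsInDegree_fortySeven_of_char_157 K
  · exact not_holdsInDegree_fortyEight_of_char_157 K
  · exact not_holdsInDegree_fortyNine_of_char_157 K
  · exact not_holdsInDegree_fifty_of_char_157 K
  · exact not_holdsInDegree_fiftyOne_of_char_157 K
  · exact not_holdsInDegree_fiftyTwo_of_char_157 K
  · exact not_holdsInDegree_fiftyThree_of_char_157 K
  · exact not_holdsInDegree_fiftyFour_of_char_157 K
  · exact not_holdsInDegree_fiftyFive_of_char_157 K
  · exact not_holdsInDegree_fiftySix_of_char_157 K
  · exact not_holdsInDegree_fiftySeven_of_char_157 K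
  · exact not_holdsInDegree_fiftyEight_of_char_157 K
  · exact not_holdsInDegree_fiftyNine_of_char_157 K
  · exact not_holdsInDegree_sixty_of_char_157 K
  · exact not_holdsInDegree_sixtyOne_of_char_157 K
  · exact not_holdsInDegree_sixtyTwo_of_char_157 K
  · exact not_holdsInDegree_sixtyThree_of_char_157 K
  · exact not_holdsInDegree_sixtyFour_of_char_157 K
  · exact not_holdsInDegree_sixtyFive_of_char_157 K
  · exact not_holdsInDegree_sixtySix_of_char_157 K
  · exact not_holdsInDegree_sixtySeven_of_char_157 K
  · exact not_holdsInDegree_sixtyEight_of_char_157 K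
  · exact not_holdsInDegree_of_choose_modEq_one K 157 (d := 69) (m := 16) (by norm_num) (by norm_num) (by decide)
  · exact not_holdsInDegree_seventy_of_char_157 K
  · exact not_holdsInDegree_seventyOne_of_char_157 K
  · exact not_holdsInDegree_seventyTwo_of_char_157 K
  · exact not_holdsInDegree_seventyThree_of_char_157 K
  · exact not_holdsInDegree_seventyFour_of_char_157 K
  · exact not_holdsInDegree_seventyFive_of_char_157 K
  · exact not_holdsInDegree_seventySix_of_char_157 K
  · exact not_holdsInDegree_seventySeven_of_char_157 K
  · exact not_holdsInDegree_seventyEight_of_char_157 K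
  · exact not_holdsInDegree_seventyNine_of_char_157 K
  · exact not_holdsInDegree_of_choose_modEq_one K 157 (d := 80) (m := 22) (by norm_num) (by norm_num) (by decide)
  · exact not_holdsInDegree_of_choose_modEq_one K 157 (d := 81) (m := 8) (by norm_num) (by norm_num) (by decide)
  · exact not_holdsInDegree_eightyTwo_of_char_157 K
  · exact not_holdsInDegree_of_choose_modEq_one K 157 (d := 83) (m := 8) (by norm_num) (by norm_num) (by decide)
  · exact not_holdsInDegree_eightyFour_of_char_157 K
  · exact not_holdsInDegree_eightyFive_of_char_157 K
  · exact not_holdsInDegree_eightySix_of_char_157 K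
  · exact not_holdsInDegree_eightySeven_of_char_157 K
  · exact not_holdsInDegree_eightyEight_of_char_157 K
  · exact not_holdsInDegree_eightyNine_of_char_157 K
  · exact not_holdsInDegree_ninety_of_char_157 K
  · exact not_holdsInDegree_ninetyOne_of_char_157 K
  · exact not_holdsInDegree_ninetyTwo_of_char_157 K
  · exact not_holdsInDegree_ninetyThree_of_char_157 K
  · exact not_holdsInDegree_of_choose_modEq_one K 157 (d := 94) (m := 7) (by norm_num) (by norm_num) (by decide)
  · exact not_holdsInDegree_ninetyFive_of_char_157 K
  · exact not_holdsInDegree_ninetySix_of_char_157 K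
  · exact not_holdsInDegree_ninetySeven_of_char_157 K
  · exact not_holdsInDegree_of_choose_modEq_one K 157 (d := 98) (m := 22) (by norm_num) (by norm_num) (by decide)
  · exact not_holdsInDegree_of_choose_modEq_one K 157 (d := 99) (m := 39) (by norm_num) (by norm_num) (by decide)
  · exact not_holdsInDegree_oneHundred_of_char_157 K
  · exact not_holdsInDegree_oneHundredOne_of_char_157 K
  · exact not_holdsInDegree_oneHundredTwo_of_char_157 K
  · exact not_holdsInDegree_of_choose_modEq_one K 157 (d := 103) (m := 16) (by norm_num) (by norm_num) (by decide)
  · exact not_holdsInDegree_oneHundredFour_of_char_157 K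
  · exact not_holdsInDegree_of_choose_modEq_one K 157 (d := 105) (m := 45) (by norm_num) (by norm_num) (by decide)
  · exact not_holdsInDegree_oneHundredSix_of_char_157 K
  · exact not_holdsInDegree_oneHundredSeven_of_char_157 K
  · exact not_holdsInDegree_oneHundredEight_of_char_157 K
  · exact not_holdsInDegree_oneHundredNine_of_char_157 K
  · exact not_holdsInDegree_oneHundredTen_of_char_157 K
  · exact not_holdsInDegree_of_choose_modEq_one K 157 (d := 111) (m := 51) (by norm_num) (by norm_num) (by decide)
  · exact not_holdsInDegree_oneHundredTwelve_of_char_157 K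
  · exact not_holdsInDegree_oneHundredThirteen_of_char_157 K
  · exact not_holdsInDegree_of_choose_modEq_one K 157 (d := 114) (m := 15) (by norm_num) (by norm_num) (by decide)
  · exact not_holdsInDegree_oneHundredFifteen_of_char_157 K
  · exact not_holdsInDegree_oneHundredSixteen_of_char_157 K
  · exact not_holdsInDegree_of_choose_modEq_one K 157 (d := 117) (m := 57) (by norm_num) (by norm_num) (by decide)
  · exact not_holdsInDegree_oneHundredEighteen_of_char_157 K
  · exact not_holdsInDegree_oneHundredNineteen_of_char_157 K
  · exact not_holdsInDegree_oneHundredTwenty_of_char_157 K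
  · exact not_holdsInDegree_oneHundredTwentyOne_of_char_157 K
  · exact not_holdsInDegree_oneHundredTwentyTwo_of_char_157 K
  · exact not_holdsInDegree_oneHundredTwentyThree_of_char_157 K
  · exact not_holdsInDegree_oneHundredTwentyFour_of_char_157 K
  · exact not_holdsInDegree_of_choose_modEq_one K 157 (d := 125) (m := 8) (by norm_num) (by norm_num) (by decide)
  · exact not_holdsInDegree_oneHundredTwentySix_of_char_157 K
  · exact not_holdsInDegree_of_choose_modEq_one K 157 (d := 127) (m := 40) (by norm_num) (by norm_num) (by decide)
  · exact not_holdsInDegree_oneHundredTwentyEight_of_char_157 K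
  · exact not_holdsInDegree_oneHundredTwentyNine_of_char_157 K
  · exact not_holdsInDegree_oneHundredThirty_of_char_157 K
  · exact not_holdsInDegree_oneHundredThirtyOne_of_char_157 K
  · exact not_holdsInDegree_of_choose_modEq_one K 157 (d := 132) (m := 6) (by norm_num) (by norm_num) (by decide)
  · exact not_holdsInDegree_oneHundredThirtyThree_of_char_157 K
  · exact not_holdsInDegree_of_choose_modEq_one K 157 (d := 134) (m := 51) (by norm_num) (by norm_num) (by decide)
  · exact not_holdsInDegree_oneHundredThirtyFive_of_char_157 K
  · exact not_holdsInDegree_oneHundredThirtySix_of_char_157 K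
  · exact not_holdsInDegree_of_choose_modEq_one K 157 (d := 137) (m := 9) (by norm_num) (by norm_num) (by decide)
  · exact not_holdsInDegree_oneHundredThirtyEight_of_char_157 K
  · exact not_holdsInDegree_oneHundredThirtyNine_of_char_157 K
  · exact not_holdsInDegree_oneHundredForty_of_char_157 K
  · exact not_holdsInDegree_oneHundredFortyOne_of_char_157 K
  · exact not_holdsInDegree_oneHundredFortyTwo_of_char_157 K
  · exact not_holdsInDegree_oneHundredFortyThree_of_char_157 K
  · exact not_holdsInDegree_oneHundredFortyFour_of_char_157 K
  · exact not_holdsInDegree_oneHundredFortyFive_of_char_157 K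
  · exact not_holdsInDegree_of_choose_modEq_one K 157 (d := 146) (m := 6) (by norm_num) (by norm_num) (by decide)
  · exact not_holdsInDegree_of_choose_modEq_one K 157 (d := 147) (m := 19) (by norm_num) (by norm_num) (by decide)
  · exact not_holdsInDegree_oneHundredFortyEight_of_char_157 K
  · exact not_holdsInDegree_oneHundredFortyNine_of_char_157 K
  · exact not_holdsInDegree_of_choose_modEq_one K 157 (d := 150) (m := 10) (by norm_num) (by norm_num) (by decide)
  · exact not_holdsInDegree_oneHundredFiftyOne_of_char_157 K
  · exact not_holdsInDegree_oneHundredFiftyTwo_of_char_157 K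
  · exact not_holdsInDegree_oneHundredFiftyThree_of_char_157 K
  · exact not_holdsInDegree_oneHundredFiftyFour_of_char_157 K
  · exact not_holdsInDegree_oneHundredFiftyFive_of_char_157 K
  · exact not_holdsInDegree_of_choose_modEq_one K 157 (d := 156) (m := 2) (by norm_num) (by norm_num) (by decide)

/-- the positive digits `1 ≤ a ≤ 5`: `CA_{a·157^k}` over every field of characteristic `157`. [cite: GrafVonBothmerEtAl2007, Props. 2, 6]
[cite: CastryckLaterveerOunaies2012, Thm. 4] -/
theorem holdsInDegree_mul_oneHundredFiftySeven_pow_of_le_five {a : ℕ} (ha0 : 0 < a) (ha5 : a ≤ 5) (k : ℕ) :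
    HoldsInDegree K (a * 157 ^ k) := by
  haveI : Fact (Nat.Prime 157) := ⟨by norm_num⟩
  interval_cases a
  · simpa using holdsInDegree_prime_pow_field K 157 k
  · exact holdsInDegree_two_mul_prime_pow_field K 157 k
  · exact holdsInDegree_three_mul_prime_pow_field K 157 (by norm_num) k
  · exact holdsInDegree_mul_prime_pow_field K 157
      (holdsInDegree_of_le_four_of_charP (AlgebraicClosure K) 157 (by norm_num) le_rfl) k
  · exact holdsInDegree_five_mul_prime_pow_field K 157 (by norm_num) (by norm_num) (by norm_num) (by norm_num)
      (by norm_num) (by norm_num) (by norm_num) (by norm_num) (by norm_num) k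

/-- **characteristic 157, complete**: over every field of characteristic `157`,
`CA_d ⟺ d = 0 ∨ d = a·157^k` with `1 ≤ a ≤ 7`. [cite: GrafVonBothmerEtAl2007, Props. 2, 6, 7]
[cite: CastryckLaterveerOunaies2012, Thm. 4] -/
theorem classification_char_oneHundredFiftySeven_complete (d : ℕ) :
    HoldsInDegree K d ↔ d = 0 ∨ ∃ k a : ℕ, 0 < a ∧ a ≤ 7 ∧ d = a * 157 ^ k := by
  haveI : Fact (Nat.Prime 157) := ⟨by norm_num⟩
  constructor
  · intro h
    rcases Nat.eq_zero_or_pos d with rfl | hd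
    · exact Or.inl rfl
    obtain ⟨k, a, ha0, hap, rfl, ha⟩ := digit_of_holdsInDegree K 157 hd.ne' h
    refine Or.inr ⟨k, a, ha0, ?_, rfl⟩
    by_contra h7
    exact not_holdsInDegree_digit_of_char_oneHundredFiftySeven K (by omega) hap ha
  · rintro (rfl | ⟨k, a, ha0, ha7, rfl⟩)
    · exact holdsInDegree_zero K
    · rcases Nat.lt_or_ge a 6 with ha | ha
      · exact holdsInDegree_mul_oneHundredFiftySeven_pow_of_le_five K ha0 (by omega) k
      · rcases Nat.lt_or_ge a 7 with ha' | ha'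
        · obtain rfl : a = 6 := by omega
          exact holdsInDegree_six_mul_pow_of_char_157' K k
        · obtain rfl : a = 7 := le_antisymm ha7 ha'
          exact holdsInDegree_seven_mul_pow_of_char_157 (K := K) k

/-- the set of Casas-Alvero degrees `≤ 24649` in characteristic `157`, explicitly (corollary of the classification:
[cite: GrafVonBothmerEtAl2007, Prop. 6] with [cite: CastryckLaterveerOunaies2012, Thm. 4] and the digit refutations above). -/
theorem holdsInDegree_iff_mem_of_le_char_oneHundredFiftySeven_sq {d : ℕ} (hd : d ≤ 24649) :
    HoldsInDegree K d ↔ d ∈ ({0, 1, 2, 3, 4, 5, 6, 7, 157, 314, 471, 628, 785, 942, 1099, 24649} : Finset ℕ) := by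
  rw [classification_char_oneHundredFiftySeven_complete]
  constructor
  · rintro (rfl | ⟨k, a, ha0, ha7, rfl⟩)
    · decide
    · rcases k with _ | _ | _ | k
      · interval_cases a <;> decide
      · interval_cases a <;> decide
      · interval_cases a <;> simp_all
      · exfalso
        have : 157 ^ 3 ≤ a * 157 ^ (k + 1 + 1 + 1) :=
          le_trans (Nat.pow_le_pow_right (by norm_num) (by omega)) (Nat.le_mul_of_pos_left _ ha0)
        omega
  · intro h
    simp only [Finset.mem_insert, Finset.mem_singleton] at h
    rcases h with rfl | rfl | rfl | rfl | rfl | rfl | rfl | rfl | rfl | rfl | rfl | rfl | rfl | rfl | rfl | rfl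
    · exact Or.inl rfl
    · exact Or.inr ⟨0, 1, by norm_num, by norm_num, by norm_num⟩
    · exact Or.inr ⟨0, 2, by norm_num, by norm_num, by norm_num⟩
    · exact Or.inr ⟨0, 3, by norm_num, by norm_num, by norm_num⟩
    · exact Or.inr ⟨0, 4, by norm_num, by norm_num, by norm_num⟩
    · exact Or.inr ⟨0, 5, by norm_num, by norm_num, by norm_num⟩
    · exact Or.inr ⟨0, 6, by norm_num, by norm_num, by norm_num⟩
    · exact Or.inr ⟨0, 7, by norm_num, by norm_num, by norm_num⟩
    · exact Or.inr ⟨1, 1, by norm_num, by norm_num, by norm_num⟩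
    · exact Or.inr ⟨1, 2, by norm_num, by norm_num, by norm_num⟩
    · exact Or.inr ⟨1, 3, by norm_num, by norm_num, by norm_num⟩
    · exact Or.inr ⟨1, 4, by norm_num, by norm_num, by norm_num⟩
    · exact Or.inr ⟨1, 5, by norm_num, by norm_num, by norm_num⟩
    · exact Or.inr ⟨1, 6, by norm_num, by norm_num, by norm_num⟩
    · exact Or.inr ⟨1, 7, by norm_num, by norm_num, by norm_num⟩
    · exact Or.inr ⟨2, 1, by norm_num, by norm_num, by norm_num⟩

end CharOneHundredFiftySeven

end Literature.Algebra.Polynomial.CasasAlvero
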